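import Summits.HubbardSuperconductivity.HubbardSuperconductivity.Theorems.BalabanIRBirComplexStableXYRCovarianceFRDMatrix
import Literature.MathematicalPhysics.QuantumFieldTheory.TorusChartCochains
import HarnessLib

/-!
# Crux `BirComplexStableXYR` (stmt-HubbardSuperconductivity-14845), line `fat-gaussian-defect-calculus`, chapter 1
# (lead c7, exact Fröhlich–Spencer unfolding): the thin Gaussian form on EXACT cochains is the site Hessian form

Support file (prover seat 1, route BalabanIR; item G1 of lead c7's 10:55Z list, model-specific half).

Lead c7's summed window Hessian ("thin") form of a real `1`-cochain `ω` on the space–time torus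
`Λ L M = (Fin 2 → ZMod L) × ZMod M` (chart `TorusChart.piProdZMod 2 L M`; registered stub `stub_thinFormCoercive`)
evaluates, in the window with corner `s`, the window Hessian `−Re Σ_n c_n (n·v)²` on the **path configuration**
`v_w =` staircase sum of `ω` from `s` to `sh L M s w` (`w.1` edges in direction `0`, then `w.2.1` in direction `1`,
then `w.2.2` in direction `2`).  For an exact cochain `ω = d₀ φ` the staircase sum telescopes to
`φ (sh L M s w) − φ s` (`tfe_pathSum_d₀`, from `TorusChart.lineSum_d₀` and the endpoint identity `tfe_sh_eq`), the
constant `φ s` drops out of `n·v` by neutrality (N) (`Σ_w n_w = 0`), and what is left is the translate-summed real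
Hessian `Q_c(φ) = Re(−Σ_s Σ_n c_n (n·(φ∘sh s))²)` of `gaussianCoercive`, i.e. the quadratic form `φᵀ H_c φ` of the
inline site Hessian matrix of the landed covariance stubs (`cfrd_form_eq`, file `…CovarianceFRDMatrix`):

* `tfe_thinForm_d₀_eq_re` — thin form of `d₀ φ` `=` `Q_c(φ)`;
* `thinForm_d0_eq_hessianForm` — thin form of `d₀ φ` `= φ ⬝ᵥ (H_c *ᵥ φ)` (registered stub of this seat on the crux item).

Consequently every landed statement about `H_c` (`birHessian_le_smul_one`, `birHessian_covarianceFRD{,_gradient,_decay,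
_quasi1D}`, `birHessian_fluctuation_{smallField,polymerGas,reflection}`) applies verbatim to the Gaussian
`e^{−(K/2)·thinForm(d₀ψ)}` produced by the square completion of chapter 1.

No definitions; sorry-free. [folklore]
-/

noncomputable section

namespace Summit.HubbardSuperconductivity.HubbardSuperconductivity.Theorems

set_option linter.dupNamespace false -- summit = problem name (single-conjunct summit), D-0017

open scoped BigOperators Matrix ComplexConjugate
open Complex Summit.HubbardSuperconductivity.BirComplexStableXYNegative
open Literature.Probability.LatticeModels Literature.MathematicalPhysics.QuantumFieldTheory

section ThinFormExact

variable {r : ℕ} {L M : ℕ} [NeZero L] [NeZero M]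

/-! ## The chart's unit translations and the window corner map -/

/-- Direction `0` of the space–time chart is the first spatial unit translation. [folklore] -/
theorem tfe_gen_zero : (TorusChart.piProdZMod 2 L M).gen 0 = (Pi.single 0 1, 0) :=
  TorusChart.piProdZMod_gen_castSucc 2 L M 0

/-- Direction `1` of the space–time chart is the second spatial unit translation. [folklore] -/
theorem tfe_gen_one : (TorusChart.piProdZMod 2 L M).gen 1 = (Pi.single 1 1, 0) :=
  TorusChart.piProdZMod_gen_castSucc 2 L M 1

/-- Direction `2` of the space–time chart is the temporal unit translation. [folklore] -/
theorem tfe_gen_two : (TorusChart.piProdZMod 2 L M).gen 2 = (0, 1) :=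
  TorusChart.piProdZMod_gen_last 2 L M

/-- **Endpoint identity**: the window site `sh L M s w` is reached from the corner `s` by `w.1` steps in direction
`0`, `w.2.1` steps in direction `1` and `w.2.2` steps in direction `2`. [folklore] -/
theorem tfe_sh_eq (s : Λ L M) (w : W r) :
    sh L M s w = s + (w.1 : ℕ) • (TorusChart.piProdZMod 2 L M).gen 0 + (w.2.1 : ℕ) • (TorusChart.piProdZMod 2 L M).gen 1 + (w.2.2 : ℕ) • (TorusChart.piProdZMod 2 L M).gen 2 := by
  rw [tfe_gen_zero, tfe_gen_one, tfe_gen_two]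
  ext i
  · simp only [sh, Prod.fst_add, Pi.add_apply, nsmul_eq_mul]
    fin_cases i <;> simp
  · simp [sh, nsmul_eq_mul]

/-- **Telescoping of the staircase sum of a gradient**: for `ω = d₀ φ` the window path configuration at `w` is
`φ (sh L M s w) − φ s`. [folklore] -/
theorem tfe_pathSum_d₀ (φ : Λ L M → ℝ) (s : Λ L M) (w : W r) :
    (TorusChart.piProdZMod 2 L M).lineSum ((TorusChart.piProdZMod 2 L M).d₀ φ) 0 (w.1 : ℕ) s
      + (TorusChart.piProdZMod 2 L M).lineSum ((TorusChart.piProdZMod 2 L M).d₀ φ) 1 (w.2.1 : ℕ) (s + (w.1 : ℕ) • (TorusChart.piProdZMod 2 L M).gen 0)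
      + (TorusChart.piProdZMod 2 L M).lineSum ((TorusChart.piProdZMod 2 L M).d₀ φ) 2 (w.2.2 : ℕ)
          (s + (w.1 : ℕ) • (TorusChart.piProdZMod 2 L M).gen 0 + (w.2.1 : ℕ) • (TorusChart.piProdZMod 2 L M).gen 1)
      = φ (sh L M s w) - φ s := by
  rw [TorusChart.lineSum_d₀, TorusChart.lineSum_d₀, TorusChart.lineSum_d₀, tfe_sh_eq]
  ring

/-- Under neutrality (N) the constant `φ s` drops out of the frequency pairing with the path configuration.
[folklore] -/
theorem tfe_freqSum_pathSum_d₀ (φ : Λ L M → ℝ) (s : Λ L M) {n : Freq r} (hn : ∑ w, n w = 0) :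
    (∑ w : W r, (n w : ℝ) *
        ((TorusChart.piProdZMod 2 L M).lineSum ((TorusChart.piProdZMod 2 L M).d₀ φ) 0 (w.1 : ℕ) s
          + (TorusChart.piProdZMod 2 L M).lineSum ((TorusChart.piProdZMod 2 L M).d₀ φ) 1 (w.2.1 : ℕ) (s + (w.1 : ℕ) • (TorusChart.piProdZMod 2 L M).gen 0)
          + (TorusChart.piProdZMod 2 L M).lineSum ((TorusChart.piProdZMod 2 L M).d₀ φ) 2 (w.2.2 : ℕ)
              (s + (w.1 : ℕ) • (TorusChart.piProdZMod 2 L M).gen 0 + (w.2.1 : ℕ) • (TorusChart.piProdZMod 2 L M).gen 1)))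
      = ∑ w : W r, (n w : ℝ) * φ (sh L M s w) := by
  simp only [tfe_pathSum_d₀, mul_sub, Finset.sum_sub_distrib, ← Finset.sum_mul]
  have h : (∑ w : W r, (n w : ℝ)) = 0 := by exact_mod_cast hn
  rw [h, zero_mul, sub_zero]

/-- **Thin form of an exact cochain, `Re`-form**: lead c7's summed window Hessian form evaluated at `ω = d₀ φ` equals
the translate-summed real Hessian `Q_c(φ) = Re(−Σ_s Σ_n c_n (n·(φ∘sh s))²)` of `gaussianCoercive`. [folklore] -/
theorem tfe_thinForm_d₀_eq_re (c : Table r) (hN : ∀ n ∈ c.support, ∑ w, n w = 0) (φ : Λ L M → ℝ) :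
    (∑ s : Λ L M, (-c.sum (fun n a => a * (((∑ w : W r, (n w : ℝ) *
        ((TorusChart.piProdZMod 2 L M).lineSum ((TorusChart.piProdZMod 2 L M).d₀ φ) 0 (w.1 : ℕ) s
          + (TorusChart.piProdZMod 2 L M).lineSum ((TorusChart.piProdZMod 2 L M).d₀ φ) 1 (w.2.1 : ℕ) (s + (w.1 : ℕ) • (TorusChart.piProdZMod 2 L M).gen 0)
          + (TorusChart.piProdZMod 2 L M).lineSum ((TorusChart.piProdZMod 2 L M).d₀ φ) 2 (w.2.2 : ℕ)
              (s + (w.1 : ℕ) • (TorusChart.piProdZMod 2 L M).gen 0 + (w.2.1 : ℕ) • (TorusChart.piProdZMod 2 L M).gen 1))) ^ 2 : ℝ) : ℂ))).re)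
      = (-∑ s : Λ L M, c.sum (fun n a => a * (((∑ w, (n w : ℝ) * φ (sh L M s w)) ^ 2 : ℝ) : ℂ))).re := by
  rw [neg_re, re_sum, ← Finset.sum_neg_distrib]
  refine Finset.sum_congr rfl fun s _ => ?_
  rw [neg_re]
  congr 2
  refine Finsupp.sum_congr fun n hn => ?_
  rw [tfe_freqSum_pathSum_d₀ φ s (hN n hn)]

/-- **Thin form of an exact cochain = site Hessian quadratic form** (registered stub `thinForm_d0_eq_hessianForm` of
prover seat 1 on stmt-HubbardSuperconductivity-14845; item G1 of lead c7's chapter 1): for every neutral table `c` and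
every real field `φ` on `Λ L M`, lead c7's thin form of `d₀ φ` equals `φ ⬝ᵥ (H_c *ᵥ φ)` with `H_c` the inline site
Hessian matrix of the covariance stubs `birHessian_*`. [folklore] -/
theorem thinForm_d0_eq_hessianForm : ∀ (r : ℕ) (c : Table r), (∀ n ∈ c.support, ∑ w, n w = 0) → ∀ (L M : ℕ) [NeZero L] [NeZero M] (φ : Λ L M → ℝ), (∑ s : Λ L M, (-c.sum (fun n a => a * (((∑ w : W r, (n w : ℝ) * ((Literature.MathematicalPhysics.QuantumFieldTheory.TorusChart.piProdZMod 2 L M).lineSum ((Literature.MathematicalPhysics.QuantumFieldTheory.TorusChart.piProdZMod 2 L M).d₀ φ) 0 (w.1 : ℕ) s + (Literature.MathematicalPhysics.QuantumFieldTheory.TorusChart.piProdZMod 2 L M).lineSum ((Literature.MathematicalPhysics.QuantumFieldTheory.TorusChart.piProdZMod 2 L M).d₀ φ) 1 (w.2.1 : ℕ) (s + (w.1 : ℕ) • (Literature.MathematicalPhysics.QuantumFieldTheory.TorusChart.piProdZMod 2 L M).gen 0) + (Literature.MathematicalPhysics.QuantumFieldTheory.TorusChart.piProdZMod 2 L M).lineSum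 ((Literature.MathematicalPhysics.QuantumFieldTheory.TorusChart.piProdZMod 2 L M).d₀ φ) 2 (w.2.2 : ℕ) (s + (w.1 : ℕ) • (Literature.MathematicalPhysics.QuantumFieldTheory.TorusChart.piProdZMod 2 L M).gen 0 + (w.2.1 : ℕ) • (Literature.MathematicalPhysics.QuantumFieldTheory.TorusChart.piProdZMod 2 L M).gen 1))) ^ 2 : ℝ) : ℂ))).re) = φ ⬝ᵥ ((Matrix.of fun i j : Λ L M => (-(∑ k : Λ L M × ↥c.support, c k.2 * ((∑ w, ((k.2 : Freq r) w : ℝ) * (if sh L M k.1 w = i then (1 : ℝ) else 0) : ℝ) : ℂ) * ((∑ w, ((k.2 : Freq r) w : ℝ) * (if sh L M k.1 w = j then (1 : ℝ) else 0) : ℝ) : ℂ))).re) *ᵥ φ) := by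
  intro r c hN L M _ _ φ
  rw [tfe_thinForm_d₀_eq_re c hN φ]
  exact cfrd_form_eq c φ

end ThinFormExact

end Summit.HubbardSuperconductivity.HubbardSuperconductivity.Theorems

end
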